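import Mathlib
import Summits.Ventures.PercRepro2.TwoHullMasterKeyedPend
import Summits.Ventures.PercRepro2.TwoHullMasterBlocksGlue2

/-!
# A pendant graph keeps a keyed cover keyed, II: the merged blocks and the cover (blind cell
PercRepro2, night-4 g40, 2026-08-29; proofs/NIGHT4-G40.md §15)

The blocks at whose key vertex the pendant sits (`keyedBlock_pend_at`: the pendant's colouring is
complemented with the interface bit, the pendant's vertices join the key class), and the cover
theorem **`keyedCover_pend`**: gluing an arbitrary graph at a classified vertex of the side keeps
a keyed cover keyed.  Iterated from `keyedCover_path` over the vertices of a path, with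
`cubeCover_glue_h` for a graph at `h`: the cube-cover conjecture on every path decorated with
arbitrary graphs at its vertices — every tree among them — in the kernel.
-/

namespace Summit.Ventures.PercRepro2

namespace Blocks

open Hull LocRows Path2 Glue Glue2

open scoped Classical

universe u

variable {V : Type*} {E₁ : Type*} {E₂ : Type u} {ends₁ : E₁ → Sym2 V} {ends₂ : E₂ → Sym2 V}
  {c l h : V} {V₁ V₂ : Set V} {β : Type*} {ι : β → Type u}
  {pt : ∀ b, (ι b → Bool) → Config E₁} {sbit : ∀ b, (ι b → Bool) → Bool}
  {Before At After : β → Set V}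

/-- **A merged block of the glued graph is keyed.** -/
theorem keyedBlock_pend_at (hg : IsGluing ends₁ ends₂ c V₁ V₂) (hl : l ∈ V₁) (hh : h ∈ V₁)
    (hhc : h ≠ c) (bc : {b : β // c ∈ At b} × Config E₂)
    (hk : KeyedBlock ends₁ l h (pt bc.1.1) (sbit bc.1.1) (Before bc.1.1) (At bc.1.1) (After bc.1.1))
    (hsub : Before bc.1.1 ⊆ V₁ ∧ At bc.1.1 ⊆ V₁ ∧ After bc.1.1 ⊆ V₁) :
    KeyedBlock (Glue.glue ends₁ ends₂) l h (pendPt' (E₂ := E₂) pt sbit Before At c (Sum.inr bc))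
      (pendSbit (E₂ := E₂) sbit At c (Sum.inr bc)) (pendBefore (E₂ := E₂) Before At c V₂ (Sum.inr bc))
      (pendAt (E₂ := E₂) At c V₂ (Sum.inr bc))
      (pendAfter (E₂ := E₂) Before At After c V₂ (Sum.inr bc)) := by
  obtain ⟨⟨b, hb⟩, c₂⟩ := bc
  simp only at hk hsub
  set pend : (ι b → Bool) → Config E₂ := fun ε => if sbit b ε = true then blue c₂ else c₂ with hpend
  have hζ : ∀ ε : ι b → Bool, pendPt' (E₂ := E₂) pt sbit Before At c (Sum.inr (⟨b, hb⟩, c₂)) ε =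
      pair (pt b ε) (pend ε) := fun ε => rfl
  have hsbit : ∀ ε : ι b → Bool,
      pendSbit (E₂ := E₂) sbit At c (Sum.inr (⟨b, hb⟩, c₂)) ε = sbit b ε := fun ε => rfl
  set q₂ := hullPair ends₂ c₂ c with hq₂
  have hq : ∀ ε, hullPair ends₂ (pend ε) c = if sbit b ε = true then q₂.swap else q₂ := by
    intro ε
    by_cases hs : sbit b ε = true
    · simp [hpend, hs, hullPair_blue, hq₂]
    · simp [hpend, hs, hq₂]
  have hPl : ∀ ε : ι b → Bool,
      hullPair (Glue.glue ends₁ ends₂) (pair (pt b ε) (pend ε)) l =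
        pendPair (hullPair ends₁ (pt b ε) l) c (if sbit b ε = true then q₂.swap else q₂) := by
    intro ε
    rw [hullPair_glue_pend hg hl, pair_inl, pair_inr, hq]
  have hPh : ∀ ε : ι b → Bool,
      hullPair (Glue.glue ends₁ ends₂) (pair (pt b ε) (pend ε)) h =
        pendPair (hullPair ends₁ (pt b ε) h) c (if sbit b ε = true then q₂.swap else q₂) := by
    intro ε
    rw [hullPair_glue_pend hg hh, pair_inl, pair_inr, hq]
  have hmem : ∀ ε, h ∉ hull (Glue.glue ends₁ ends₂) (pair (pt b ε) (pend ε)) l := fun ε => by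
    rw [notMem_hull_glue_iff hg hl hh hhc, pair_inl]; exact hk.block.mem _
  refine ⟨⟨?_, fun ε => by rw [hζ]; exact hmem ε, ?_, ?_, ?_⟩, ?_, ?_, ?_, ?_, ?_, ?_, ?_, ?_⟩
  · intro ε ε' heq
    rw [hζ, hζ] at heq
    have h1 := congrArg (fun ξ => ξ ∘ Sum.inl) heq
    simp only [pair_inl] at h1
    exact hk.block.inj h1
  · -- P_l monotone
    intro ε ε' hle
    rw [hζ, hζ, hPl, hPl]
    have hs := hk.sbit_mono hle
    rcases Bool.eq_false_or_eq_true (sbit b ε) with h1 | h1 <;>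
      rcases Bool.eq_false_or_eq_true (sbit b ε') with h2 | h2
    · rw [h1, h2]; exact pendPair_mono_left (hk.block.l_mono hle)
    · rw [h1, h2] at hs; exact absurd (Bool.le_iff_imp.1 hs rfl) (by decide)
    · rw [h1, h2]; simp only [Bool.false_eq_true, if_false, if_true]
      exact pendPair_le_swap (hk.block.l_mono hle) (hk.at_l_red c hb ε h1) (hk.at_l_blue c hb ε' h2)
    · rw [h1, h2]; simp only [Bool.false_eq_true, if_false]
      exact pendPair_mono_left (hk.block.l_mono hle)
  · -- P_h antitone
    intro ε ε' hle
    rw [hζ, hζ, hPh, hPh]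
    have hs := hk.sbit_mono hle
    rcases Bool.eq_false_or_eq_true (sbit b ε) with h1 | h1 <;>
      rcases Bool.eq_false_or_eq_true (sbit b ε') with h2 | h2
    · rw [h1, h2]; exact pendPair_mono_left (hk.block.h_anti hle)
    · rw [h1, h2] at hs; exact absurd (Bool.le_iff_imp.1 hs rfl) (by decide)
    · rw [h1, h2]; simp only [Bool.false_eq_true, if_false, if_true]
      have := pendPair_le_swap (c := c) (q₂ := q₂.swap) (hk.block.h_anti hle)
        (hk.at_h_red c hb ε' h2) (hk.at_h_blue c hb ε h1)
      rwa [Prod.swap_swap] at this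
    · rw [h1, h2]; simp only [Bool.false_eq_true, if_false]
      exact pendPair_mono_left (hk.block.h_anti hle)
  · -- mirror
    rcases hk.block.mirror with hm | hm
    · left
      intro ε
      rw [hζ, hζ, hPl, hPl]
      show pendPair (hullPair ends₁ (pt b (cubeNot (ε : ι b → Bool))) l) c
          (if sbit b (cubeNot (ε : ι b → Bool)) = true then q₂.swap else q₂) = _
      rw [hk.sbit_not, hm, pendPair_swap]
      cases sbit b ε <;> simp
    · right
      intro ε
      rw [hζ, hζ, hPh, hPh]
      show pendPair (hullPair ends₁ (pt b (cubeNot (ε : ι b → Bool))) h) c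
          (if sbit b (cubeNot (ε : ι b → Bool)) = true then q₂.swap else q₂) = _
      rw [hk.sbit_not, hm, pendPair_swap]
      cases sbit b ε <;> simp
  · intro ε ε' hle; rw [hsbit, hsbit]; exact hk.sbit_mono hle
  · intro ε; rw [hsbit, hsbit]; exact hk.sbit_not ε
  · -- before
    intro x hx ε
    rw [hζ]
    simp only [pendBefore] at hx
    rw [(mem_glue_pair_side hg hh _ _ (hsub.1 hx)).1, (mem_glue_pair_side hg hh _ _ (hsub.1 hx)).2]
    exact hk.before x hx _
  · -- after
    intro x hx ε
    rw [hζ]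
    simp only [pendAfter] at hx
    rw [(mem_glue_pair_side hg hl _ _ (hsub.2.2 hx)).1,
      (mem_glue_pair_side hg hl _ _ (hsub.2.2 hx)).2]
    exact hk.after x hx _
  · -- at, l red
    intro x hx ε hs
    rw [hsbit] at hs
    rw [hζ]
    simp only [pendAt] at hx
    rcases hx with hx | hx
    · rw [(mem_glue_pair_side hg hl _ _ (hsub.2.1 hx)).1]; exact hk.at_l_red x hx ε hs
    · exact (notMem_glue_pair_of_c hg hl _ _ hx).1 (hk.at_l_red c hb ε hs)
  · intro x hx ε hs
    rw [hsbit] at hs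
    rw [hζ]
    simp only [pendAt] at hx
    rcases hx with hx | hx
    · rw [(mem_glue_pair_side hg hl _ _ (hsub.2.1 hx)).2]; exact hk.at_l_blue x hx ε hs
    · exact (notMem_glue_pair_of_c hg hl _ _ hx).2 (hk.at_l_blue c hb ε hs)
  · intro x hx ε hs
    rw [hsbit] at hs
    rw [hζ]
    simp only [pendAt] at hx
    rcases hx with hx | hx
    · rw [(mem_glue_pair_side hg hh _ _ (hsub.2.1 hx)).1]; exact hk.at_h_red x hx ε hs
    · exact (notMem_glue_pair_of_c hg hh _ _ hx).1 (hk.at_h_red c hb ε hs)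
  · intro x hx ε hs
    rw [hsbit] at hs
    rw [hζ]
    simp only [pendAt] at hx
    rcases hx with hx | hx
    · rw [(mem_glue_pair_side hg hh _ _ (hsub.2.1 hx)).2]; exact hk.at_h_blue x hx ε hs
    · exact (notMem_glue_pair_of_c hg hh _ _ hx).2 (hk.at_h_blue c hb ε hs)

/-- `freePend` is an involution. -/
lemma freePend_freePend (Before : β → Set V) (c : V) (b : β) (ζ₂ : Config E₂) :
    freePend Before c b (freePend Before c b ζ₂) = ζ₂ := by
  simp only [freePend]
  split_ifs <;> simp [blue_blue]

/-- **A pendant graph keeps a keyed cover keyed.** -/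
theorem keyedCover_pend (hg : IsGluing ends₁ ends₂ c V₁ V₂) (hl : l ∈ V₁) (hh : h ∈ V₁) (hhc : h ≠ c)
    (hk : KeyedCover ends₁ l h pt sbit Before At After)
    (hclass : ∀ b, c ∈ Before b ∨ c ∈ At b ∨ c ∈ After b)
    (hsub : ∀ b, Before b ⊆ V₁ ∧ At b ⊆ V₁ ∧ After b ⊆ V₁) :
    KeyedCover (Glue.glue ends₁ ends₂) l h (pendPt' (E₂ := E₂) pt sbit Before At c)
      (pendSbit (E₂ := E₂) sbit At c) (pendBefore (E₂ := E₂) Before At c V₂)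
      (pendAt (E₂ := E₂) At c V₂) (pendAfter (E₂ := E₂) Before At After c V₂) := by
  have hkeyed : ∀ b' : pendβ (β := β) E₂ At c,
      KeyedBlock (Glue.glue ends₁ ends₂) l h (pendPt' (E₂ := E₂) pt sbit Before At c b')
        (pendSbit (E₂ := E₂) sbit At c b') (pendBefore (E₂ := E₂) Before At c V₂ b')
        (pendAt (E₂ := E₂) At c V₂ b') (pendAfter (E₂ := E₂) Before At After c V₂ b') := by
    intro b'
    cases b' with
    | inl b =>
      refine keyedBlock_pend_free hg hl hh hhc b (hk.keyed b.1) ?_ (hsub b.1)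
      rcases hclass b.1 with h1 | h2 | h3
      · exact Or.inl h1
      · exact absurd h2 b.2
      · exact Or.inr h3
    | inr bc => exact keyedBlock_pend_at hg hl hh hhc bc (hk.keyed bc.1.1) (hsub bc.1.1)
  refine ⟨⟨fun b' => (hkeyed b').block, ?_, ?_⟩, hkeyed⟩
  · -- cover
    intro ζ hζ
    rw [notMem_hull_glue_iff hg hl hh hhc] at hζ
    obtain ⟨b, ε, he⟩ := hk.cover.cover _ hζ
    by_cases hb : c ∈ At b
    · refine ⟨Sum.inr (⟨b, hb⟩, if sbit b ε = true then blue (ζ ∘ Sum.inr) else ζ ∘ Sum.inr), ε, ?_⟩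
      show pair (pt b ε) (if sbit b ε = true then
          blue (if sbit b ε = true then blue (ζ ∘ Sum.inr) else ζ ∘ Sum.inr)
        else (if sbit b ε = true then blue (ζ ∘ Sum.inr) else ζ ∘ Sum.inr)) = ζ
      rw [he]
      by_cases hs : sbit b ε = true
      · simp [hs, blue_blue, pair_comp]
      · simp [hs, pair_comp]
    · refine ⟨Sum.inl ⟨b, hb⟩, Sum.elim ε (freePend Before c b (ζ ∘ Sum.inr)), ?_⟩
      show pair (pt b ((Sum.elim ε (freePend Before c b (ζ ∘ Sum.inr))) ∘ Sum.inl))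
        (freePend Before c b ((Sum.elim ε (freePend Before c b (ζ ∘ Sum.inr))) ∘ Sum.inr)) = ζ
      have e1 : (Sum.elim ε (freePend Before c b (ζ ∘ Sum.inr)) ∘ Sum.inl : ι b → Bool) = ε := rfl
      have e2 : (Sum.elim ε (freePend Before c b (ζ ∘ Sum.inr)) ∘ Sum.inr : Config E₂) =
          freePend Before c b (ζ ∘ Sum.inr) := rfl
      rw [e1, e2, freePend_freePend, he, pair_comp]
  · -- disjoint
    intro b₁ b₂ ε₁ ε₂ heq
    have h1 : pendPt' (E₂ := E₂) pt sbit Before At c b₁ ε₁ ∘ Sum.inl =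
        pendPt' (E₂ := E₂) pt sbit Before At c b₂ ε₂ ∘ Sum.inl := congrArg (fun ξ => ξ ∘ Sum.inl) heq
    have h2 : pendPt' (E₂ := E₂) pt sbit Before At c b₁ ε₁ ∘ Sum.inr =
        pendPt' (E₂ := E₂) pt sbit Before At c b₂ ε₂ ∘ Sum.inr := congrArg (fun ξ => ξ ∘ Sum.inr) heq
    cases b₁ with
    | inl b =>
      cases b₂ with
      | inl b' =>
        have : b.1 = b'.1 := hk.cover.disj _ _ _ _ h1
        exact congrArg Sum.inl (Subtype.ext this)
      | inr bc =>
        have : b.1 = bc.1.1 := hk.cover.disj _ _ _ _ h1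
        exact absurd (this ▸ bc.1.2) b.2
    | inr bc =>
      cases b₂ with
      | inl b' =>
        have : bc.1.1 = b'.1 := hk.cover.disj _ _ _ _ h1
        exact absurd (this ▸ bc.1.2) b'.2
      | inr bc' =>
        obtain ⟨⟨b, hb⟩, c₂⟩ := bc
        obtain ⟨⟨b', hb'⟩, c₂'⟩ := bc'
        have hbb : b = b' := hk.cover.disj _ _ _ _ h1
        subst hbb
        have hε : ε₁ = ε₂ := (hk.keyed b).block.inj h1
        subst hε
        simp only [pendPt', pair_inr] at h2
        have hc : c₂ = c₂' := by
          by_cases hs : sbit b ε₁ = true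
          · simp only [hs, if_true] at h2
            exact blue_injective h2
          · simpa [hs] using h2
        subst hc
        rfl

/-- **The mirror on `l` passes to the glued blocks**: with it, `cubeCover_glue2` composes decorated
paths in parallel (theta graphs of decorated paths). -/
theorem lMirror_pend (hg : IsGluing ends₁ ends₂ c V₁ V₂) (hl : l ∈ V₁)
    (hk : KeyedCover ends₁ l h pt sbit Before At After) (hm : LMirror ends₁ l pt) :
    LMirror (Glue.glue ends₁ ends₂) l (pendPt' (E₂ := E₂) pt sbit Before At c) := by
  intro b' ε
  cases b' with
  | inl b =>
    show hullPair (Glue.glue ends₁ ends₂)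
        (pair (pt b.1 (cubeNot ε ∘ Sum.inl)) (freePend Before c b.1 (cubeNot ε ∘ Sum.inr))) l =
      (hullPair (Glue.glue ends₁ ends₂)
        (pair (pt b.1 (ε ∘ Sum.inl)) (freePend Before c b.1 (ε ∘ Sum.inr))) l).swap
    have e1 : (cubeNot ε ∘ Sum.inl : ι b.1 → Bool) = cubeNot (ε ∘ Sum.inl) := rfl
    have e2 : freePend Before c b.1 (cubeNot ε ∘ Sum.inr) =
        blue (freePend Before c b.1 (ε ∘ Sum.inr)) := by
      show freePend Before c b.1 (blue (ε ∘ Sum.inr)) = _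
      rw [freePend_blue]
    rw [hullPair_glue_pend hg hl, hullPair_glue_pend hg hl, pair_inl, pair_inr, pair_inl, pair_inr,
      e1, e2, hm, hullPair_blue, pendPair_swap]
  | inr bc =>
    obtain ⟨⟨b, hb⟩, c₂⟩ := bc
    show hullPair (Glue.glue ends₁ ends₂)
        (pair (pt b (cubeNot (ε : ι b → Bool)))
          (if sbit b (cubeNot (ε : ι b → Bool)) = true then blue c₂ else c₂)) l =
      (hullPair (Glue.glue ends₁ ends₂)
        (pair (pt b ε) (if sbit b ε = true then blue c₂ else c₂)) l).swap
    rw [hullPair_glue_pend hg hl, hullPair_glue_pend hg hl, pair_inl, pair_inr, pair_inl, pair_inr,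
      (hk.keyed b).sbit_not, hm, pendPair_swap]
    cases sbit b ε <;> simp [hullPair_blue]

end Blocks

end Summit.Ventures.PercRepro2
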